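import Summits.CriticalPhenomena.Ising3DConformalLimit.Theses.MonotoneRG
import Summits.CriticalPhenomena.Ising3DConformalLimit.Theses.HyperoctahedralRP
import Summits.CriticalPhenomena.Ising3DConformalLimit.Theorems.HyperoctahedralRPLimitRotationInvariant
import Summits.CriticalPhenomena.Ising3DConformalLimit.Theorems.HyperoctahedralRPHRP2Rigidity
import HarnessLib
import HarnessLib.Audit

/-!
# Birth skeleton (BC3) for crux `MonotoneRG.CovarianceUpgrade` — item stmt-CriticalPhenomena-5957

Route `route-CriticalPhenomena-MonotoneRG`, sub-problem `Ising3DConformalLimit`, crux rank 6 (the route's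
IMPORTED COMPLEMENT: "isotropy, inversion, U₄ ≢ 0 — other routes' business").  Registered file
`Cruxes/CovarianceUpgrade/Lines/birth.lean` (skeleton registrar `planner-skel-stmt-CriticalPhenomena-5957-0`,
2026-08-17).  Two named stubs `stub_*` (the ONLY `sorry`s of this file), the sorry-free composition
`CovarianceUpgrade_of : <stub (I)> → <stub (U)> → MonotoneRG.CovarianceUpgrade` (hypotheses written as the
definitionally equal item names `HyperoctahedralRP.InversionUpgradeNormalised` /
`HyperoctahedralRP.IsingEuclidUpgradeR4NonGaussian`), and the zero-hypothesis wiring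
`CovarianceUpgrade_of_stubs : MonotoneRG.CovarianceUpgrade := CovarianceUpgrade_of stub_… stub_…`; both conclude
literally the route decl `Summit.CriticalPhenomena.Ising3DConformalLimit.Theses.MonotoneRG.CovarianceUpgrade`.

THE CRUX (by name `MonotoneRG.CovarianceUpgrade`; grounded g13-29 / g39-14, refuter-checked g44-63):

  `∀ ρ Δ S, (∀ δ ∈ (0,1], 0 < ρ δ) → 0 < Δ → HasPointwiseScalingLimit (criticalCorr 3) ρ S →
     (S = 0 off NonCoincident) → IsNondegenerateTwoPoint S → IsTranslationInvariant S → IsScaleCovariant Δ S →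
     IsMoebiusCovariant Δ S ∧ HasNontrivialU4 S`.

Since `IsMoebiusCovariant Δ S = (IsTranslationInvariant S ∧ IsRotationInvariant S) ∧ IsScaleCovariant Δ S ∧
IsInversionCovariant Δ S` (`Literature/Probability/LatticeModels/ConformalCovariance.lean`), and translation
invariance and scale covariance are HYPOTHESES, the crux has exactly three pieces of content:

* (R) ROTATION INVARIANCE of every such limit — a THEOREM in tree: item stmt-1980
  `HyperoctahedralRP.LimitRotationInvariant` (`Cruxes.LimitRotationInvariant.QuarterTurnLiouville.LimitRotationInvariant_of`,
  Theorems/HyperoctahedralRPLimitRotationInvariant.lean) fed with the PROVED item stmt-1979 `HRP2Rigidity`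
  (`Cruxes.HRP2Rigidity.XRayMellin.HRP2Rigidity_of`, Theorems/HyperoctahedralRPHRP2Rigidity.lean): nine-mirror
  reflection positivity + homogeneity ⇒ two-point isotropy (HRP₂ rigidity) ⇒ all orders (crux stmt-8367).  Used
  in the composition BY NAME — not a stub (BC4: a known theorem is cited, not re-filed).
* (I) THE INVERSION UPGRADE — OPEN: `stub_inversionUpgradeNormalised`, VERBATIM the shared item stmt-1982
  `HyperoctahedralRP.InversionUpgradeNormalised` (13 routes want it; live crux chain
  `Cruxes/InversionUpgradeNormalised`, line `inversion-defect-involution` with open lattice-ratio stubs C, D).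
* (U) NON-GAUSSIANITY — OPEN: `stub_nonGaussian`, VERBATIM the shared item stmt-0636
  `IsingEuclidUpgradeR4NonGaussian` (30+ routes want it; Aizenman's double-current intersection criterion).

COMPOSITION (`CovarianceUpgrade_of`, kernel-checked, no `sorry` of its own): given the seven hypotheses of the
crux, (R) gives `IsRotationInvariant S`, hence `IsEuclideanInvariant S := ⟨transl, rot⟩`; (I) applied to
(ρ, Δ, S) with that Euclidean invariance gives `IsInversionCovariant Δ S`; `IsMoebiusCovariant Δ S :=
⟨Euclid, scale, inversion⟩`; (U) applied to (ρ, S) gives `HasNontrivialU4 S`.  The hypothesis `0 < Δ` of the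
crux is not needed by either stub (in tree `Δ ∈ [1/2, 1]` anyway, `scalingDimension_mem_Icc_holds`).  The two
stubs are stated with the EXACT typings of items 1982 / 0636 (fully qualified, so the registered signatures
dedup against those items by normalised signature; the identifications are certified below by `Iff.rfl`):
the day either item lands in `Theorems/`, the corresponding stub closes by `exact`.

WHY THIS CUT AND NOT ANOTHER.  The crux is, by its own item text, "the conjunction of items of routes
HyperoctahedralRP (LimitRotationInvariant∘HRP2Rigidity, InversionUpgradeNormalised = stmt-1982) and
IsingEuclidUpgrade (stmt-0636)"; since 2026-08-16 the first conjunct is proved, so the honest skeleton has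
exactly two open stubs and a composition that does real work (the rotation theorem).  Weaker re-typings of
(I)/(U) using the crux's spare hypotheses (`0 < Δ`; for (U) full Möbius covariance) were considered and
rejected for the birth line: (I) with `0 < Δ` added is equivalent in tree to 1982 (`delta_mem_Icc_of_hyp`),
and (U) "U₄ ≢ 0 for Möbius-covariant Ising limits" has the same open core (non-triviality in d = 3) while
losing the dedup with the 30 routes staffing 0636 — a conformal-bootstrap-flavoured (U') is a candidate for a
second LINE (crux-plan), not for the birth certificate.

DISPROOF / NEGATIVES USED.  No `Cruxes/CovarianceUpgrade/Disproof.lean` exists (crux dir empty at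
registration, `ledger crux ls stmt-CriticalPhenomena-5957`).  The standing negative knowledge on piece (I) is
honoured: `Theorems/InversionUpgradeNormalised/Negative/LoadBearingHypotheses.lean` proves the inversion
upgrade FALSE without the lattice-limit clause (`not_cruxWithoutIsingLimit`, barrier
`ScaleCovarianceNotMoebius` narrow family, every Δ > 0), without the normalisation clause
(`not_cruxWithoutNormalisation` = `IsingEuclidUpgrade.not_inversionUpgrade_of_euclideanLimit`, the refuted
un-normalised item 0637) and without scale covariance (`not_cruxWithoutScaleCovariance`) — `stub_inversionUpgradeNormalised`
keeps ALL six hypotheses of item 1982 verbatim (limit clause H2, normalisation H3, scale covariance H6 are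
used where the composition feeds it), so it is an instance of none of these refuted weakenings; nor of
`Negative/ReflectionMonotone.lean`, `Negative/SixPointWitness.lean` (model-blind lattice surrogates).  Piece
(U): the model-blind statement is false (barriers `LongRangeTrivialityOnZ3`, `IsingTrivialityFromDimensionFour`:
Gaussian limits of RP long-range models on ℤ³ / of n.n. Ising in d ≥ 4); `stub_nonGaussian` carries the
`criticalCorr 3` (nearest-neighbour, d = 3) limit hypothesis of item 0636 verbatim.  `ledger negatives
--problem CriticalPhenomena` (11 entries, 2026-08-17): none concerns this sub-problem's items 1982 / 0636.

BC3 AUDIT (planner folder `bc/`, raw outputs in the registrar's NOTES.md): `lean check --json` rc 0, sorries =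
2 = #stubs (`stub_inversionUpgradeNormalised`, `stub_nonGaussian`), zero elsewhere; probes
`stub → MonotoneRG.CovarianceUpgrade` and `stub → Ising3DConformalLimit` by
`first | exact? | simpa [·] | (unfold ·; simpa) | aesop` FAIL for both stubs (4/4): (I) lacks U₄ ≢ 0, (U) lacks
the inversion upgrade, and the summit needs existence of the limit (item 1981, the route's Target) on top.
-/

noncomputable section

namespace Summit.CriticalPhenomena.Ising3DConformalLimit.Cruxes.CovarianceUpgrade.Birth

open Summit.CriticalPhenomena.Ising3DConformalLimit.Theses

/-! ## The two registered stubs (the only `sorry`s of this file) -/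

/-- **STUB (I) — the inversion upgrade (VERBATIM item stmt-CriticalPhenomena-1982
`HyperoctahedralRP.InversionUpgradeNormalised`).**  Every pointwise scaling limit `S` of the critical
nearest-neighbour Ising correlators on `ℤ³` (`ρ > 0` on `(0,1]`) that is normalised (`S = 0` off
`NonCoincident`), has non-degenerate two-point function, is Euclidean invariant and scale covariant with
weight `Δ` is inversion covariant with the same `Δ` (hence Möbius covariant).  Polyakov's postulate for Ising₃
(Poland–Rychkov–Vichi 2019 §II eq. (2)); OPEN.  The model-blind statement is false (free Maxwell field in
`d = 3`, El-Showk–Nakayama–Rychkov 2011; tree barrier `ScaleCovarianceNotMoebius`; `not_cruxWithoutIsingLimit`),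
so a proof must use the lattice hypothesis (reflection positivity + locality / absence of a dimension-2 virial
current); live line: `Cruxes/InversionUpgradeNormalised/Lines/inversion-defect-involution` (one-sided
lattice ratio inequalities at even orders ≥ 4).  Size: open problem.
[cite: PolandRychkovVichi2019, §II eq. (2)] -/
theorem stub_inversionUpgradeNormalised :
    ∀ (ρ : ℝ → ℝ) (Δ : ℝ) (S : Literature.Probability.LatticeModels.CorrFamily 3), (∀ δ ∈ Set.Ioc (0:ℝ) 1, 0 < ρ δ) → Literature.Probability.LatticeModels.HasPointwiseScalingLimit (Literature.Probability.LatticeModels.criticalCorr 3) ρ S → (∀ n z, z ∉ Literature.Probability.LatticeModels.NonCoincident 3 n → S n z = 0) → Literature.Probability.LatticeModels.IsNondegenerateTwoPoint S → Literature.Probability.LatticeModels.IsEuclideanInvariant S → Literature.Probability.LatticeModels.IsScaleCovariant Δ S → Literature.Probability.LatticeModels.IsInversionCovariant Δ S := by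
  sorry

/-- **STUB (U) — non-Gaussianity (VERBATIM item stmt-CriticalPhenomena-0636 `IsingEuclidUpgradeR4NonGaussian`).**
Every pointwise scaling limit `S` of the renormalised critical nearest-neighbour Ising correlators on `ℤ³`
(`ρ > 0` on `(0,1]`) with non-degenerate two-point function has connected four-point function `U₄ ≢ 0` on
non-coincident configurations.  OPEN (non-triviality in `d = 3`): by the random-current identity
`U₄(x,y,z,t) = −2⟨σ_xσ_y⟩⟨σ_zσ_t⟩·P[C(x) ∩ C(z) ≠ ∅]` (Aizenman 1982; Aizenman–Duminil-Copin, Ann. Math. 194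
(2021), eq. (3.11)) it says the double-current intersection probability at macroscopic separation does not
vanish as `δ → 0`; theorems in print go the other way (Gaussian limits for n.n. `d = 4`, and for RP long-range
models on `ℤ³` — barriers `IsingTrivialityFromDimensionFour`, `LongRangeTrivialityOnZ3`), so the `criticalCorr 3`
hypothesis is load-bearing.  Size: open problem.
[cite: AizenmanDuminilCopinAnnals2021, eq. (3.11)] -/
theorem stub_nonGaussian :
    ∀ (ρ : ℝ → ℝ) (S : Literature.Probability.LatticeModels.CorrFamily 3), (∀ δ ∈ Set.Ioc (0:ℝ) 1, 0 < ρ δ) → Literature.Probability.LatticeModels.HasPointwiseScalingLimit (Literature.Probability.LatticeModels.criticalCorr 3) ρ S → Literature.Probability.LatticeModels.IsNondegenerateTwoPoint S → Literature.Probability.LatticeModels.HasNontrivialU4 S := by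
  sorry

/-! ## Identification of the stubs with the shared items (definitional) -/

-- Stub (I) IS item stmt-1982 of route `HyperoctahedralRP` (same text, definitionally).
example : (type_of% stub_inversionUpgradeNormalised) ↔ HyperoctahedralRP.InversionUpgradeNormalised := Iff.rfl

-- Stub (U) IS item stmt-0636 (`HyperoctahedralRP.IsingEuclidUpgradeR4NonGaussian`, same text, definitionally).
example : (type_of% stub_nonGaussian) ↔ HyperoctahedralRP.IsingEuclidUpgradeR4NonGaussian := Iff.rfl

/-! ## The composition -/

/-- **THE SKELETON THEOREM** — items 1982 (inversion upgrade) and 0636 (U₄ ≢ 0) imply the crux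
`MonotoneRG.CovarianceUpgrade` BY NAME; the third ingredient, rotation invariance of the limit, is the PROVED
item 1980 (`LimitRotationInvariant_of`) fed with the PROVED item 1979 (`HRP2Rigidity_of`).  No `sorry`.
The hypotheses are the two stub statements, written as the (definitionally equal, `Iff.rfl` above) item names
so that the skeleton audit reads them as registered obligations. [folklore] -/
theorem CovarianceUpgrade_of
    (hI : HyperoctahedralRP.InversionUpgradeNormalised)
    (hU : HyperoctahedralRP.IsingEuclidUpgradeR4NonGaussian) :
    MonotoneRG.CovarianceUpgrade := by
  intro ρ Δ S hρ _hΔ hlim hnorm hnd htr hsc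
  have hrot : Literature.Probability.LatticeModels.IsRotationInvariant S :=
    Summit.CriticalPhenomena.Ising3DConformalLimit.Cruxes.LimitRotationInvariant.QuarterTurnLiouville.LimitRotationInvariant_of
      Summit.CriticalPhenomena.Ising3DConformalLimit.Cruxes.HRP2Rigidity.XRayMellin.HRP2Rigidity_of
      ρ Δ S hρ hlim hnorm hnd htr hsc
  have heuc : Literature.Probability.LatticeModels.IsEuclideanInvariant S := ⟨htr, hrot⟩
  have hinv : Literature.Probability.LatticeModels.IsInversionCovariant Δ S :=
    hI ρ Δ S hρ hlim hnorm hnd heuc hsc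
  exact ⟨⟨heuc, hsc, hinv⟩, hU ρ S hρ hlim hnd⟩

/-- **Wiring (the skeleton read with zero hypotheses)**: the two registered stubs feed `CovarianceUpgrade_of`
as stated, giving the crux BY NAME modulo exactly the two `sorry`s above (no `sorry` of its own; its axiom
closure contains `sorryAx` only through `stub_inversionUpgradeNormalised` / `stub_nonGaussian`). [folklore] -/
theorem CovarianceUpgrade_of_stubs : MonotoneRG.CovarianceUpgrade :=
  CovarianceUpgrade_of stub_inversionUpgradeNormalised stub_nonGaussian

end Summit.CriticalPhenomena.Ising3DConformalLimit.Cruxes.CovarianceUpgrade.Birth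

end
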